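import Summits.BirchSwinnertonDyer.BirchSwinnertonDyer.Theorems.ByReductionTypeAtTwoFineSelmerConjAAtTwoAdditivePotGoodClassNumberOddCriterion
import HarnessLib

/-!
# Route `ByReductionTypeAtTwo` (rung K4), crux C1″ `FineSelmerConjAAtTwoAdditivePotGood` (item stmt-BirchSwinnertonDyer-22615):
# A CYCLIC-CLASS-GROUP CRITERION FOR CUBIC FIELDS — `Cl(K) = ⟨[𝔮]⟩` for an explicit prime `𝔮 = (ℓ₀, θ − r₀)` of degree one,
# from a Minkowski sweep whose witnesses are elements of norm `ℓ · m` with `m` supported on primes already treated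
# (a `--supports 22615` toolkit file; seat `bsd-2adic-k4-w1` GEN 7; sequel of `…ClassNumberOneCriterion` / `…ClassNumberOddCriterion` (GEN 6);
# consumed by the per-row capitulation certificates of the «Fukuda rows»)

HONEST FRAMING (cell `bsd-2adic`, D-0036/D-0054): UNCONDITIONAL kernel lemmas about cubic number fields; closes nothing; nothing booked;
BSD is not proved by any of this.

PURPOSE. The census rows of C1″ with EVEN `h(ℚ(P))` («Fukuda rows») need, for the capitulation door (`…CapitulationDoorLayerOne`,
p707404), the divisibility `h_K ∣ ord [𝔮]` for ONE explicit prime `𝔮` of `K = ℚ(P)` — i.e. that `[𝔮]` generates `Cl(K)`; no class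
number has to be computed. This file proves it from a finite certificate, Dedekind–Kummer-free:

* `eq_span_pair_of_absNorm_eq_of_sub_mem` — a prime `Q` of norm `ℓ` with `θ ≡ r (mod Q)` EQUALS `(ℓ, θ − r)` as soon as `ℓ² ∤ g(r)`
  (another prime factor of `(ℓ, θ − r)` would put `θ − r` into a product of two ideals of norm divisible by `ℓ`);
* `exists_absNorm_eq_of_dvd_eval` — conversely `ℓ ∣ g(r)`, `ℓ² ∤ g(r)` produce such a prime (a prime factor of `(θ − r)`), so
  `absNorm (ℓ, θ − r) = ℓ` (`absNorm_span_pair_eq_of_dvd_eval`);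
* `classIn_above_of_pairWitnesses` — ONE SWEEP STEP: if every prime above each `ℓ' ∈ S` has class in `H`, and for every root `a` of the
  cubic mod `ℓ` either `(ℓ, θ − a)` is a KNOWN ideal with class in `H` or there is a (possibly fractional) element `ω ∈ (ℓ, θ − a)` with
  `|N ω| = ℓ · m`, `m` a product of primes from `S`, then every prime above `ℓ` has class in `H` (degree `2`: `(ℓ) = P·J`; degree `3`: `P = (ℓ)`);
* `subgroup_eq_top_of_forall_prime_lt` — if this holds for every prime `ℓ < B` with `M_K < B`, then `H = ⊤` (Minkowski); with
  `H = ⟨[𝔮]⟩`: `h_K = ord [𝔮]` (`classNumber_eq_orderOf_of_zpowers_eq_top`).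

References: [Marcus1977] Ch. 3 Thm. 22, Ch. 5 Thm. 35–37 and the class-group computations after Cor. 2; [Cohen1993] §4.8.2, §6.3 (prime
ideals `(ℓ, θ − a)`), §6.5 (relations from norms); [Neukirch1999] I.§3.
-/

set_option autoImplicit false
-- sibling precedent (`…ClassNumberOddCriterion.lean`): the directory name repeats the summit name
set_option linter.dupNamespace false

noncomputable section

open scoped Classical IntermediateField NumberField Real nonZeroDivisors

namespace Summit.BirchSwinnertonDyer.BirchSwinnertonDyer.Theorems.AddKatoTwo

open Polynomial IsDedekindDomain NumberField UniqueFactorizationMonoid Literature.NumberTheory.NumberFields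

variable (K : Type) [Field K] [NumberField K]

/-! ## §1 Primes of degree one: `(ℓ, θ − r)` -/

/-- **Two rational primes in a proper ideal coincide.** [folklore] -/
theorem natCast_prime_eq_of_mem {P : Ideal (𝓞 K)} (hP : P ≠ ⊤) {ℓ ℓ' : ℕ} (hℓ : ℓ.Prime) (hℓ' : ℓ'.Prime)
    (h : ((ℓ : ℕ) : 𝓞 K) ∈ P) (h' : ((ℓ' : ℕ) : 𝓞 K) ∈ P) : ℓ = ℓ' := by
  by_contra hne
  have hcop : Nat.Coprime ℓ ℓ' := (Nat.coprime_primes hℓ hℓ').mpr hne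
  apply hP
  rw [Ideal.eq_top_iff_one]
  obtain ⟨u, v, huv⟩ := Nat.isCoprime_iff_coprime.mpr hcop
  have : (1 : 𝓞 K) = (u : 𝓞 K) * ((ℓ : ℕ) : 𝓞 K) + (v : 𝓞 K) * ((ℓ' : ℕ) : 𝓞 K) := by exact_mod_cast congrArg (Int.cast (R := 𝓞 K)) huv.symm
  rw [this]
  exact P.add_mem (P.mul_mem_left _ h) (P.mul_mem_left _ h')

/-- **The norm of a prime above `ℓ` is `ℓ`, `ℓ²` or `ℓ³`** (cubic `K`), in the form «`absNorm P = ℓ ^ i`, `1 ≤ i ≤ 3`» for the GIVEN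
rational prime `ℓ ∈ P`. [cite: Marcus1977, Ch. 3 Thm. 21–22] -/
theorem absNorm_eq_pow_of_natCast_mem (h3 : Module.finrank ℚ K = 3) {P : Ideal (𝓞 K)} (hP : P.IsPrime) (hP0 : P ≠ ⊥)
    {ℓ : ℕ} (hℓ : ℓ.Prime) (hℓP : ((ℓ : ℕ) : 𝓞 K) ∈ P) : ∃ i : ℕ, 1 ≤ i ∧ i ≤ 3 ∧ Ideal.absNorm P = ℓ ^ i := by
  obtain ⟨ℓ', hℓ', hℓ'P, i, hi1, hi3, hN⟩ := exists_prime_natCast_mem K h3 hP hP0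
  have := natCast_prime_eq_of_mem K hP.ne_top hℓ hℓ' hℓP hℓ'P
  subst this
  exact ⟨i, hi1, hi3, hN⟩

/-- **`|N(θ − r)| = |g(r)|`** for a root `θ ∈ 𝓞 K` of the irreducible `g = X³ + pX² + qX + r₀` and `r ∈ ℕ`. [cite: Marcus1977, Ch. 2 Thm. 4] -/
theorem natAbs_norm_sub_natCast (h3 : Module.finrank ℚ K = 3) (b : 𝓞 K) {p q r : ℤ}
    (hirr : Irreducible (Cubic.toPoly ⟨1, (p : ℚ), q, r⟩)) (hb : b ^ 3 + p * b ^ 2 + q * b + r = 0) (a : ℕ) :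
    (Algebra.norm ℤ (b - (a : 𝓞 K))).natAbs = ((a : ℤ) ^ 3 + p * (a : ℤ) ^ 2 + q * a + r).natAbs := by
  have h := natAbs_norm_coords_eq_natAbs_normPoly K h3 b hirr hb (-(a : ℤ)) 1 0
  have he : ((-(a : ℤ) : ℤ) : 𝓞 K) + (1 : ℤ) * b + (0 : ℤ) * b ^ 2 = b - (a : 𝓞 K) := by push_cast; ring
  rw [he] at h
  rw [h]
  have : (-(a : ℤ)) ^ 3 - p * (-(a : ℤ)) ^ 2 * 1 + (p ^ 2 - 2 * q) * (-(a : ℤ)) ^ 2 * 0 + q * -(a : ℤ) * 1 ^ 2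
      + (3 * r - p * q) * -(a : ℤ) * 1 * 0 + (q ^ 2 - 2 * p * r) * -(a : ℤ) * 0 ^ 2 - r * 1 ^ 3 + p * r * 1 ^ 2 * 0
      - q * r * 1 * 0 ^ 2 + r ^ 2 * 0 ^ 3 = -((a : ℤ) ^ 3 + p * (a : ℤ) ^ 2 + q * a + r) := by ring
  rw [this, Int.natAbs_neg]

/-- **A prime `Q` of norm `ℓ` with `θ ≡ r (mod Q)` equals `(ℓ, θ − r)` when `ℓ² ∤ g(r)`.** Write `(ℓ, θ − r) = Q · R`; if `R ≠ ⊤` take a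
maximal `M ⊇ R`: if `M = Q` then `θ − r ∈ Q²`, else `θ − r ∈ Q ⊓ M = Q·M` with `ℓ ∣ N(M)`; either way `ℓ² ∣ N(θ − r) = |g(r)|`. KERNEL,
no index hypothesis. [cite: Marcus1977, Ch. 3 Thm. 27 (the ideals `(p, θ − a)`) and Ch. 5 Thm. 37] [cite: Cohen1993, §4.8.2] -/
theorem eq_span_pair_of_absNorm_eq_of_sub_mem (h3 : Module.finrank ℚ K = 3) (b : 𝓞 K) {p q r : ℤ}
    (hirr : Irreducible (Cubic.toPoly ⟨1, (p : ℚ), q, r⟩)) (hb : b ^ 3 + p * b ^ 2 + q * b + r = 0)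
    {ℓ : ℕ} (hℓ : ℓ.Prime) {a : ℕ} (hsq : ¬ ((ℓ : ℤ) ^ 2 ∣ (a : ℤ) ^ 3 + p * (a : ℤ) ^ 2 + q * a + r))
    {Q : Ideal (𝓞 K)} (hQ : Ideal.absNorm Q = ℓ) (hab : b - (a : 𝓞 K) ∈ Q) :
    Q = Ideal.span {((ℓ : ℕ) : 𝓞 K), b - (a : 𝓞 K)} := by
  have hℓQ : ((ℓ : ℕ) : 𝓞 K) ∈ Q := by have := Ideal.absNorm_mem Q; rwa [hQ] at this
  have hQprime : Q.IsPrime := Ideal.isPrime_of_irreducible_absNorm (by rw [hQ]; exact hℓ)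
  have hQ0 : Q ≠ ⊥ := by intro h; rw [h, Ideal.absNorm_bot] at hQ; exact hℓ.ne_zero hQ.symm
  haveI hQmax : Q.IsMaximal := hQprime.isMaximal hQ0
  set I := Ideal.span {((ℓ : ℕ) : 𝓞 K), b - (a : 𝓞 K)} with hI
  have hIQ : I ≤ Q := by
    rw [hI, Ideal.span_le]
    intro x hx
    rcases hx with rfl | rfl
    · exact hℓQ
    · exact hab
  obtain ⟨R, hR⟩ := Ideal.dvd_iff_le.mpr hIQ
  -- the norm obstruction: `θ − a` lies in no product `Q · M` with `ℓ ∣ N(M)`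
  have hnorm : (Algebra.norm ℤ (b - (a : 𝓞 K))).natAbs = ((a : ℤ) ^ 3 + p * (a : ℤ) ^ 2 + q * a + r).natAbs :=
    natAbs_norm_sub_natCast K h3 b hirr hb a
  have hobs : ∀ M : Ideal (𝓞 K), ℓ ∣ Ideal.absNorm M → b - (a : 𝓞 K) ∉ Q * M := by
    intro M hM hmem
    apply hsq
    have hdvd := Ideal.absNorm_dvd_absNorm_of_le ((Ideal.span_singleton_le_iff_mem _).mpr hmem)
    rw [map_mul, hQ, Ideal.absNorm_span_singleton, hnorm] at hdvd
    have h2 : ℓ ^ 2 ∣ ((a : ℤ) ^ 3 + p * (a : ℤ) ^ 2 + q * a + r).natAbs := by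
      rw [pow_two]; exact dvd_trans (Nat.mul_dvd_mul_left ℓ hM) hdvd
    have := Int.natCast_dvd.mpr h2
    push_cast at this
    exact this
  by_contra hne
  have hR1 : R ≠ ⊤ := by
    intro hR1; apply hne; rw [← Ideal.mul_top Q, ← hR1, ← hR]
  obtain ⟨M, hMmax, hRM⟩ := Ideal.exists_le_maximal R hR1
  have hIR : I ≤ R := by rw [hR]; exact Ideal.mul_le_left
  have hbM : b - (a : 𝓞 K) ∈ M := hRM (hIR (Ideal.subset_span (by simp)))
  have hℓM : ((ℓ : ℕ) : 𝓞 K) ∈ M := hRM (hIR (Ideal.subset_span (by simp)))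
  by_cases hMQ : M = Q
  · -- `θ − a ∈ I = Q R ⊆ Q M = Q²`
    have hmem : b - (a : 𝓞 K) ∈ Q * M := by
      have : b - (a : 𝓞 K) ∈ Q * R := by rw [← hR]; exact Ideal.subset_span (by simp)
      exact Ideal.mul_mono_right hRM this
    exact hobs M (by rw [hMQ, hQ]) hmem
  · -- `Q`, `M` distinct maximal: `θ − a ∈ Q ⊓ M = Q M`, and `ℓ ∣ N(M)`
    have hcop : IsCoprime Q M := (Ideal.isCoprime_iff_sup_eq.mpr (Ideal.IsMaximal.coprime_of_ne hQmax hMmax (Ne.symm hMQ)))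
    have hmem : b - (a : 𝓞 K) ∈ Q * M := by
      rw [Ideal.mul_eq_inf_of_isCoprime hcop]; exact ⟨hab, hbM⟩
    have hM0 : M ≠ ⊥ := by
      intro h; rw [h, Ideal.mem_bot] at hℓM; exact_mod_cast hℓ.ne_zero (by exact_mod_cast hℓM)
    obtain ⟨i, hi1, -, hNM⟩ := absNorm_eq_pow_of_natCast_mem K h3 hMmax.isPrime hM0 hℓ hℓM
    exact hobs M (by rw [hNM]; exact dvd_pow_self ℓ (by omega)) hmem

/-- **`ℓ ∣ g(r)`, `ℓ² ∤ g(r)` ⟹ a prime of norm `ℓ` contains `θ − r`** (a prime factor `Q` of `(θ − r)` with `ℓ ∣ N(Q)`; then `N(Q) = ℓ`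
since `N(Q) ∣ N(θ − r) = ± g(r)`). [cite: Marcus1977, Ch. 3 Thm. 22 and Ch. 5 Thm. 37] -/
theorem exists_absNorm_eq_of_dvd_eval (h3 : Module.finrank ℚ K = 3) (b : 𝓞 K) {p q r : ℤ}
    (hirr : Irreducible (Cubic.toPoly ⟨1, (p : ℚ), q, r⟩)) (hb : b ^ 3 + p * b ^ 2 + q * b + r = 0)
    {ℓ : ℕ} (hℓ : ℓ.Prime) {a : ℕ} (hdvd : (ℓ : ℤ) ∣ (a : ℤ) ^ 3 + p * (a : ℤ) ^ 2 + q * a + r)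
    (hsq : ¬ ((ℓ : ℤ) ^ 2 ∣ (a : ℤ) ^ 3 + p * (a : ℤ) ^ 2 + q * a + r)) :
    ∃ Q : Ideal (𝓞 K), Ideal.absNorm Q = ℓ ∧ b - (a : 𝓞 K) ∈ Q := by
  set β : 𝓞 K := b - (a : 𝓞 K) with hβ
  have hnorm : (Algebra.norm ℤ β).natAbs = ((a : ℤ) ^ 3 + p * (a : ℤ) ^ 2 + q * a + r).natAbs :=
    natAbs_norm_sub_natCast K h3 b hirr hb a
  have hg0 : ((a : ℤ) ^ 3 + p * (a : ℤ) ^ 2 + q * a + r) ≠ 0 := by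
    intro h0; apply hsq; rw [h0]; exact dvd_zero _
  have hβ0 : β ≠ 0 := by
    intro h0
    rw [h0, Algebra.norm_zero, Int.natAbs_zero] at hnorm
    exact hg0 (Int.natAbs_eq_zero.mp hnorm.symm)
  have hsp0 : Ideal.span {β} ≠ ⊥ := by rwa [Ne, Ideal.span_singleton_eq_bot]
  -- `ℓ` divides the product of the norms of the prime factors of `(β)`
  have hprod : (normalizedFactors (Ideal.span {β})).prod = Ideal.span {β} := Ideal.prod_normalizedFactors_eq_self hsp0
  have hNprod : ((normalizedFactors (Ideal.span {β})).map Ideal.absNorm).prod = (Algebra.norm ℤ β).natAbs := by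
    rw [← map_multiset_prod, hprod, Ideal.absNorm_span_singleton]
  have hℓdvd : ℓ ∣ ((normalizedFactors (Ideal.span {β})).map Ideal.absNorm).prod := by
    rw [hNprod, hnorm]; exact Int.natCast_dvd.mp hdvd
  obtain ⟨N, hNmem, hℓN⟩ := (Nat.prime_iff.mp hℓ).exists_mem_multiset_dvd hℓdvd
  obtain ⟨Q, hQmem, rfl⟩ := Multiset.mem_map.mp hNmem
  have hQprime : Q.IsPrime := Ideal.isPrime_of_prime (prime_of_normalized_factor Q hQmem)
  have hQ0 : Q ≠ ⊥ := (prime_of_normalized_factor Q hQmem).ne_zero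
  have hQdvd : Q ∣ Ideal.span {β} := dvd_of_mem_normalizedFactors hQmem
  have hβQ : β ∈ Q := (Ideal.span_singleton_le_iff_mem _).mp (Ideal.le_of_dvd hQdvd)
  -- `N(Q) = ℓ'^i` with `ℓ ∣ ℓ'^i`, so `ℓ' = ℓ`; and `i = 1` since `ℓ² ∤ N(β)`
  obtain ⟨ℓ', hℓ', hℓ'Q, i, hi1, hi3, hNQ⟩ := exists_prime_natCast_mem K h3 hQprime hQ0
  rw [hNQ] at hℓN
  have hℓℓ' : ℓ = ℓ' := (Nat.prime_dvd_prime_iff_eq hℓ hℓ').mp (hℓ.dvd_of_dvd_pow hℓN)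
  subst hℓℓ'
  refine ⟨Q, ?_, hβQ⟩
  have hNQdvd : Ideal.absNorm Q ∣ (Algebra.norm ℤ β).natAbs := by
    rw [← Ideal.absNorm_span_singleton]; exact Ideal.absNorm_dvd_absNorm_of_le (Ideal.le_of_dvd hQdvd)
  rw [hNQ, hnorm] at hNQdvd
  interval_cases i
  · rw [hNQ, pow_one]
  · exfalso; apply hsq; exact_mod_cast Int.natCast_dvd.mpr hNQdvd
  · exfalso; apply hsq
    have : ℓ ^ 2 ∣ ℓ ^ 3 := pow_dvd_pow ℓ (by norm_num)
    exact_mod_cast Int.natCast_dvd.mpr (dvd_trans this hNQdvd)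

/-- **`absNorm (ℓ, θ − r) = ℓ`** when `ℓ ∣ g(r)` and `ℓ² ∤ g(r)` (§1 combined): the ideal `(ℓ, θ − r)` IS the degree-one prime through
which `θ ≡ r`. [cite: Marcus1977, Ch. 3 Thm. 27] [cite: Cohen1993, §4.8.2] -/
theorem absNorm_span_pair_eq_of_dvd_eval (h3 : Module.finrank ℚ K = 3) (b : 𝓞 K) {p q r : ℤ}
    (hirr : Irreducible (Cubic.toPoly ⟨1, (p : ℚ), q, r⟩)) (hb : b ^ 3 + p * b ^ 2 + q * b + r = 0)
    {ℓ : ℕ} (hℓ : ℓ.Prime) {a : ℕ} (hdvd : (ℓ : ℤ) ∣ (a : ℤ) ^ 3 + p * (a : ℤ) ^ 2 + q * a + r)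
    (hsq : ¬ ((ℓ : ℤ) ^ 2 ∣ (a : ℤ) ^ 3 + p * (a : ℤ) ^ 2 + q * a + r)) :
    Ideal.absNorm (Ideal.span {((ℓ : ℕ) : 𝓞 K), b - (a : 𝓞 K)}) = ℓ := by
  obtain ⟨Q, hQ, hab⟩ := exists_absNorm_eq_of_dvd_eval K h3 b hirr hb hℓ hdvd hsq
  rw [← eq_span_pair_of_absNorm_eq_of_sub_mem K h3 b hirr hb hℓ hsq hQ hab, hQ]

/-! ## §2 One step of the sweep: all primes above `ℓ` from witnesses modulo already-treated primes -/

/-- Prime divisors of a number dividing a power of a product of primes from a list lie in the list. [folklore] -/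
theorem mem_of_prime_dvd_of_dvd_prod_pow {T : List ℕ} (hT : ∀ t ∈ T, t.Prime) {m e : ℕ} (hm : m ∣ T.prod ^ e)
    {ℓ : ℕ} (hℓ : ℓ.Prime) (hℓm : ℓ ∣ m) : ℓ ∈ T := by
  have h1 : ℓ ∣ T.prod := hℓ.dvd_of_dvd_pow (dvd_trans hℓm hm)
  obtain ⟨t, htT, hℓt⟩ := (Prime.dvd_prod_iff (Nat.prime_iff.mp hℓ)).mp h1
  rwa [(Nat.prime_dvd_prime_iff_eq hℓ (hT t htT)).mp hℓt]

/-- **ONE SWEEP STEP.** `K` cubic, `θ ∈ 𝓞 K` a root of the irreducible `g = X³ + pX² + qX + r`, `H ≤ Cl(K)`, `ℓ` prime, and `S` a list of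
primes such that every prime above each `ℓ' ∈ S` has class in `H`. Suppose that for every `a < ℓ` with `ℓ ∣ g(a)` EITHER `ℓ² ∤ g(a)` and the
ideal `(ℓ, θ − a)` has class in `H` (a known ideal, e.g. the generator itself), OR there is a witness: `x, y, z ∈ ℤ`, `d` prime to `ℓ` with
`ω = (x + yθ + zθ²)/d ∈ 𝓞 K`, `ℓ ∣ x + ya + za²`, and `|normPoly(x, y, z)| = d³ · ℓ · m` with `m ∣ (∏ T)^e`, `T ⊆ S`. Then EVERY prime `P ∋ ℓ`
has class in `H`: `N(P) = ℓ` — `θ ≡ a (mod P)` for a root `a`, and `P = (ℓ, θ − a)` or `(ω) = P · J` with `N(J) = m` whose prime factors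
lie above primes of `S`; `N(P) = ℓ²` — `(ℓ) = P · J` with `N(J) = ℓ`; `N(P) = ℓ³` — `P = (ℓ)`.
[cite: Marcus1977, Ch. 5 Thm. 37 and the worked examples after Cor. 2] [cite: Cohen1993, §6.5] -/
theorem classIn_above_of_pairWitnesses (h3 : Module.finrank ℚ K = 3) (b : 𝓞 K) {p q r : ℤ}
    (hirr : Irreducible (Cubic.toPoly ⟨1, (p : ℚ), q, r⟩)) (hb : b ^ 3 + p * b ^ 2 + q * b + r = 0)
    {H : Subgroup (ClassGroup (𝓞 K))} {ℓ : ℕ} (hℓ : ℓ.Prime) {S : List ℕ} (hSp : ∀ t ∈ S, t.Prime)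
    (hS : ∀ t ∈ S, ∀ P : Ideal (𝓞 K), P.IsPrime → P ≠ ⊥ → ((t : ℕ) : 𝓞 K) ∈ P → ClassIn H P)
    (hcert : ∀ a : ℕ, a < ℓ → (ℓ : ℤ) ∣ (a : ℤ) ^ 3 + p * (a : ℤ) ^ 2 + q * a + r →
      (¬ ((ℓ : ℤ) ^ 2 ∣ (a : ℤ) ^ 3 + p * (a : ℤ) ^ 2 + q * a + r) ∧ ClassIn H (Ideal.span {((ℓ : ℕ) : 𝓞 K), b - (a : 𝓞 K)})) ∨
      ∃ x y z : ℤ, ∃ d m e : ℕ, ∃ T : List ℕ, Nat.Coprime d ℓ ∧ (ℓ : ℤ) ∣ x + y * a + z * (a : ℤ) ^ 2 ∧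
        (∃ ω : 𝓞 K, (d : 𝓞 K) * ω = (x : 𝓞 K) + y * b + z * b ^ 2) ∧
        (x ^ 3 - p * x ^ 2 * y + (p ^ 2 - 2 * q) * x ^ 2 * z + q * x * y ^ 2 + (3 * r - p * q) * x * y * z
          + (q ^ 2 - 2 * p * r) * x * z ^ 2 - r * y ^ 3 + p * r * y ^ 2 * z - q * r * y * z ^ 2 + r ^ 2 * z ^ 3).natAbs = d ^ 3 * (ℓ * m) ∧
        (∀ t ∈ T, t ∈ S) ∧ m ∣ T.prod ^ e) :
    ∀ P : Ideal (𝓞 K), P.IsPrime → P ≠ ⊥ → ((ℓ : ℕ) : 𝓞 K) ∈ P → ClassIn H P := by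
  -- degree one
  have hdeg1 : ∀ Q : Ideal (𝓞 K), Ideal.absNorm Q = ℓ → ClassIn H Q := by
    intro Q hQ
    have hQprime : Q.IsPrime := Ideal.isPrime_of_irreducible_absNorm (by rw [hQ]; exact hℓ)
    have hQ0 : Q ≠ ⊥ := by intro h; rw [h, Ideal.absNorm_bot] at hQ; exact hℓ.ne_zero hQ.symm
    obtain ⟨a, ha, hab⟩ := exists_sub_natCast_mem_of_absNorm_eq_prime K hℓ hQ b
    have hroot := natCast_dvd_of_sub_mem K hℓ hQ h3 hb hab
    rcases hcert a ha hroot with ⟨hsq, hknown⟩ | ⟨x, y, z, d, m, e, T, hcop, hdvd, ⟨ω, hω⟩, hN, hTS, hmT⟩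
    · rwa [eq_span_pair_of_absNorm_eq_of_sub_mem K h3 b hirr hb hℓ hsq hQ hab]
    · have hm0 : 0 < m := by
        rcases Nat.eq_zero_or_pos m with h0 | h0
        · exfalso
          rw [h0] at hmT
          have hT0 : T.prod = 0 := (pow_eq_zero_iff'.mp (Nat.eq_zero_of_zero_dvd hmT)).1
          exact Nat.not_prime_zero (hSp 0 (hTS 0 (List.prod_eq_zero_iff.mp hT0)))
        · exact h0
      obtain ⟨hωQ, hNω⟩ := mem_and_natAbs_norm_of_fracWitness K h3 b hirr hb hℓ hQ hab hcop hdvd hω (n := ℓ * m) hN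
      refine ClassIn.of_mem_of_absNorm hQ0 hωQ hm0 (by rw [hNω, hQ]) fun Q' hQ' hQ'0 hNQ' => ?_
      obtain ⟨t, ht, htQ', i, hi1, -, hNt⟩ := exists_prime_natCast_mem K h3 hQ' hQ'0
      have htm : t ∣ m := by
        have : t ∣ Ideal.absNorm Q' := by rw [hNt]; exact dvd_pow_self t (by omega)
        exact dvd_trans this hNQ'
      exact hS t (hTS t (mem_of_prime_dvd_of_dvd_prod_pow (fun t' ht' => hSp t' (hTS t' ht')) hmT ht htm)) Q' hQ' hQ'0 htQ'
  -- all primes above `ℓ`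
  intro P hP hP0 hℓP
  obtain ⟨i, hi1, hi3, hN⟩ := absNorm_eq_pow_of_natCast_mem K h3 hP hP0 hℓ hℓP
  interval_cases i
  · exact hdeg1 P (by rw [hN, pow_one])
  · -- `(ℓ) = P · J`, `N(J) = ℓ`
    obtain ⟨J, hJ⟩ : P ∣ Ideal.span {((ℓ : ℕ) : 𝓞 K)} := Ideal.dvd_iff_le.mpr ((Ideal.span_singleton_le_iff_mem P).mpr hℓP)
    have hNℓ : Ideal.absNorm (Ideal.span {((ℓ : ℕ) : 𝓞 K)}) = ℓ ^ 3 := by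
      rw [Ideal.absNorm_span_singleton]
      have : ((ℓ : ℕ) : 𝓞 K) = algebraMap ℤ (𝓞 K) ℓ := by simp
      rw [this, Algebra.norm_algebraMap, NumberField.RingOfIntegers.rank, h3, Int.natAbs_pow]
      simp
    have hJN : Ideal.absNorm J = ℓ := by
      have h := congrArg Ideal.absNorm hJ
      rw [hNℓ, map_mul, hN, pow_succ] at h
      exact (Nat.eq_of_mul_eq_mul_left (pow_pos hℓ.pos 2) h).symm
    have hJ0 : J ≠ ⊥ := by intro h; rw [h, Ideal.absNorm_bot] at hJN; exact hℓ.ne_zero hJN.symm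
    have hPJ : ClassIn H (P * J) := hJ ▸ ClassIn.span_singleton H _
    exact ClassIn.of_mul hPJ (hdeg1 J hJN) hJ0
  · -- `P = (ℓ)`
    have hnorm : (Algebra.norm ℤ ((ℓ : ℕ) : 𝓞 K)).natAbs = ℓ ^ 3 := by
      have : ((ℓ : ℕ) : 𝓞 K) = algebraMap ℤ (𝓞 K) ℓ := by simp
      rw [this, Algebra.norm_algebraMap, NumberField.RingOfIntegers.rank, h3, Int.natAbs_pow]
      simp
    rw [eq_span_singleton_of_mem_of_absNorm_eq K (pow_ne_zero 3 hℓ.ne_zero) hN hℓP hnorm]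
    exact ClassIn.span_singleton H _

/-! ## §3 Conclusion: `H = ⊤` from the primes below the Minkowski bound, and `h_K = ord [𝔮]` -/

/-- **If every prime above each rational prime `ℓ < B` has class in `H` and `M_K < B`, then `H = Cl(K)`** (every class contains an ideal
of norm `≤ M_K`, whose prime factors have norm `≤ M_K < B`). [cite: Marcus1977, Ch. 5 Thm. 35–37 and Cor. 2] -/
theorem subgroup_eq_top_of_forall_prime_lt (h3 : Module.finrank ℚ K = 3) {B : ℕ}
    (hM : (4 / π) ^ NumberField.InfinitePlace.nrComplexPlaces K *
      ((Module.finrank ℚ K).factorial / (Module.finrank ℚ K : ℝ) ^ Module.finrank ℚ K * √|(NumberField.discr K : ℝ)|) < B)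
    {H : Subgroup (ClassGroup (𝓞 K))}
    (hall : ∀ ℓ : ℕ, ℓ < B → ℓ.Prime → ∀ P : Ideal (𝓞 K), P.IsPrime → P ≠ ⊥ → ((ℓ : ℕ) : 𝓞 K) ∈ P → ClassIn H P) :
    H = ⊤ := by
  refine (Subgroup.eq_top_iff' _).mpr fun C => ?_
  obtain ⟨I, rfl, hI⟩ := NumberField.exists_ideal_in_class_of_norm_le C
  have hIB : Ideal.absNorm (I : Ideal (𝓞 K)) < B := by exact_mod_cast hI.trans_lt hM
  have hcl : ClassIn H (I : Ideal (𝓞 K)) := by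
    refine ClassIn.of_prime_factors (nonZeroDivisors.coe_ne_zero I) fun Q hQ hQ0 hdvd => ?_
    have hQB : Ideal.absNorm Q < B :=
      lt_of_le_of_lt (Nat.le_of_dvd (Nat.pos_of_ne_zero (Ideal.absNorm_ne_zero_of_nonZeroDivisors I))
        (Ideal.absNorm_dvd_absNorm_of_le (Ideal.le_of_dvd hdvd))) hIB
    obtain ⟨ℓ, hℓ, hℓQ, i, hi1, -, hN⟩ := exists_prime_natCast_mem K h3 hQ hQ0
    have hℓB : ℓ < B := lt_of_le_of_lt (by rw [hN]; exact Nat.le_self_pow (by omega) ℓ) hQB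
    exact hall ℓ hℓB hℓ Q hQ hQ0 hℓQ
  exact hcl I.2

/-- **`h_K = ord [𝔮]`** once `⟨[𝔮]⟩ = Cl(K)`. [folklore] -/
theorem classNumber_eq_orderOf_of_zpowers_eq_top {c : ClassGroup (𝓞 K)} (h : Subgroup.zpowers c = ⊤) :
    NumberField.classNumber K = orderOf c := by
  rw [NumberField.classNumber, ← Nat.card_eq_fintype_card]
  exact (orderOf_eq_card_of_forall_mem_zpowers fun x => by rw [h]; exact Subgroup.mem_top x).symm

/-- The generator's own ideal has class in `⟨[𝔮]⟩` (the «known ideal» branch of the sweep step). [folklore] -/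
theorem classIn_zpowers_self (𝔮 : Ideal (𝓞 K)) (h𝔮 : 𝔮 ∈ (Ideal (𝓞 K))⁰) :
    ClassIn (Subgroup.zpowers (ClassGroup.mk0 ⟨𝔮, h𝔮⟩)) 𝔮 := by
  intro h
  exact Subgroup.mem_zpowers _

/-- A principal ideal has class in every `H` (the «known ideal» branch for a prime with a norm-`ℓ` generator `ω = (x + yθ + zθ²)/d`).
[folklore] -/
theorem classIn_span_pair_of_principalWitness (h3 : Module.finrank ℚ K = 3) (b : 𝓞 K) {p q r : ℤ}
    (hirr : Irreducible (Cubic.toPoly ⟨1, (p : ℚ), q, r⟩)) (hb : b ^ 3 + p * b ^ 2 + q * b + r = 0)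
    (H : Subgroup (ClassGroup (𝓞 K))) {ℓ : ℕ} (hℓ : ℓ.Prime) {a : ℕ}
    (hdvda : (ℓ : ℤ) ∣ (a : ℤ) ^ 3 + p * (a : ℤ) ^ 2 + q * a + r) (hsq : ¬ ((ℓ : ℤ) ^ 2 ∣ (a : ℤ) ^ 3 + p * (a : ℤ) ^ 2 + q * a + r))
    {x y z : ℤ} {d : ℕ} (hcop : Nat.Coprime d ℓ) (hdvd : (ℓ : ℤ) ∣ x + y * a + z * (a : ℤ) ^ 2)
    (hω : ∃ ω : 𝓞 K, (d : 𝓞 K) * ω = (x : 𝓞 K) + y * b + z * b ^ 2)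
    (hN : (x ^ 3 - p * x ^ 2 * y + (p ^ 2 - 2 * q) * x ^ 2 * z + q * x * y ^ 2 + (3 * r - p * q) * x * y * z
      + (q ^ 2 - 2 * p * r) * x * z ^ 2 - r * y ^ 3 + p * r * y ^ 2 * z - q * r * y * z ^ 2 + r ^ 2 * z ^ 3).natAbs = d ^ 3 * ℓ) :
    ClassIn H (Ideal.span {((ℓ : ℕ) : 𝓞 K), b - (a : 𝓞 K)}) := by
  have hQ := absNorm_span_pair_eq_of_dvd_eval K h3 b hirr hb hℓ hdvda hsq
  have hab : b - (a : 𝓞 K) ∈ Ideal.span {((ℓ : ℕ) : 𝓞 K), b - (a : 𝓞 K)} := Ideal.subset_span (by simp)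
  obtain ⟨ω, hω⟩ := hω
  obtain ⟨hωQ, hNω⟩ := mem_and_natAbs_norm_of_fracWitness K h3 b hirr hb hℓ hQ hab hcop hdvd hω (n := ℓ) hN
  rw [eq_span_singleton_of_mem_of_absNorm_eq K hℓ.ne_zero hQ hωQ hNω]
  exact ClassIn.span_singleton H ω

/-! ## §4 Bookkeeping for the per-field sweeps -/

/-- No condition for the empty list of treated primes. [folklore] -/
theorem forall_prime_above_nil (H : Subgroup (ClassGroup (𝓞 K))) :
    ∀ t ∈ ([] : List ℕ), ∀ P : Ideal (𝓞 K), P.IsPrime → P ≠ ⊥ → ((t : ℕ) : 𝓞 K) ∈ P → ClassIn H P := by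
  intro t ht; simp at ht

/-- Extending the list of treated primes by one. [folklore] -/
theorem forall_prime_above_cons {H : Subgroup (ClassGroup (𝓞 K))} {S : List ℕ} {ℓ : ℕ}
    (hℓ : ∀ P : Ideal (𝓞 K), P.IsPrime → P ≠ ⊥ → ((ℓ : ℕ) : 𝓞 K) ∈ P → ClassIn H P)
    (hS : ∀ t ∈ S, ∀ P : Ideal (𝓞 K), P.IsPrime → P ≠ ⊥ → ((t : ℕ) : 𝓞 K) ∈ P → ClassIn H P) :
    ∀ t ∈ ℓ :: S, ∀ P : Ideal (𝓞 K), P.IsPrime → P ≠ ⊥ → ((t : ℕ) : 𝓞 K) ∈ P → ClassIn H P := by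
  intro t ht
  rcases List.mem_cons.mp ht with rfl | ht'
  · exact hℓ
  · exact hS t ht'

/-- From a list containing every prime `< B` to the hypothesis of `subgroup_eq_top_of_forall_prime_lt`. [folklore] -/
theorem forall_prime_lt_of_forall_mem {H : Subgroup (ClassGroup (𝓞 K))} {S : List ℕ} {B : ℕ}
    (hcover : ∀ ℓ : ℕ, ℓ < B → ℓ.Prime → ℓ ∈ S)
    (hS : ∀ t ∈ S, ∀ P : Ideal (𝓞 K), P.IsPrime → P ≠ ⊥ → ((t : ℕ) : 𝓞 K) ∈ P → ClassIn H P) :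
    ∀ ℓ : ℕ, ℓ < B → ℓ.Prime → ∀ P : Ideal (𝓞 K), P.IsPrime → P ≠ ⊥ → ((ℓ : ℕ) : 𝓞 K) ∈ P → ClassIn H P :=
  fun ℓ hB hℓ => hS ℓ (hcover ℓ hB hℓ)

end Summit.BirchSwinnertonDyer.BirchSwinnertonDyer.Theorems.AddKatoTwo

end
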